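import Mathlib
import HarnessLib
import Summits.Ventures.LatticeQCDFlow.Scaling.HypercontractiveTiltedMass
import Summits.Ventures.LatticeQCDFlow.Exactness.LazyLayers

/-!
# HypercontractiveMarginals — every marginal of the switching chain with HYPERCONTRACTIVE layers is
# within `ρ√(e^{σ̄²/n²} − 1)/(1 − ρe^{3σ̄²/(4n²)}) ≈ ρσ̄/((1−ρ)n)` of its equilibrium law in the
# `L⁴(π_k)` density norm — hence in `χ²` and in every observable — with NO oscillation hypothesis

HONEST FRAMING: exact (Metropolis-corrected) sampling algorithms for lattice gauge theory;
figures of merit are autocorrelation/cost numbers at stated couplings and volumes; no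
continuum-physics claim.

Venture `LatticeQCDFlow` (cell pub-lqcd), topic `Scaling`; FANOUT row 19 (`su2-snf`, GEN-10).
OUR WORK (elementary finite sums), nothing cited as a fact.  Setting and vocabulary of
`Scaling/HypercontractiveTiltedMass` (uniform grid `c_k = k/n`, positive unit-row-sum layers `P k`
leaving `π_{(k+1)/n}` invariant with `HyperContracts (P k) π_{(k+1)/n} ρ`, `Var_c(D) ≤ σ̄²` for all
`c`, `ε = σ̄²/n²`) and row 8's marginal laws `evolveLaw P μ k` (`Exactness/LazyLayers`).

* §1 `dev4_tTiltLaw_succ_le_hc` — THE PER-STEP DEVIATION INEQUALITY for every real `t`, exported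
  (it is the `hv` step inside `tTiltMass_uniform_le_hc`):
  `dev4_{k+1} ≤ ρ·ḡ_k·(e^{(6t²−8t+3)ε/4}·dev4_k + √(e^{(t−1)²ε} − 1)·m_k)`;
* §2 AT `t = 0` THE TILTED MARGINAL IS THE MARGINAL: `tWeight 0 = 1`, `tTiltLaw 0 … k = evolveLaw P π₀ k`
  (`tTiltLaw_zero_eq_evolveLaw`), unit mass; so with `θ = ρe^{3ε/4} < 1`, `a = ρ√(e^{ε} − 1)`:
  **`dev4_evolveLaw_le_hc`** — `dev4 π_{k/n} (μ_k) ≤ a/(1−θ)` for EVERY `k` (`D_{k+1} ≤ θD_k + a`,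
  `D_0 = 0`);
* §3 consequences: **`chiSqDiv_evolveLaw_le_hc`** — `χ²(μ_k ‖ π_{k/n}) ≤ (a/(1−θ))²`, and
  **`abs_mean_evolveLaw_sub_le_hc`** — `|E_{μ_k} O − ⟨O⟩_{k/n}| ≤ √Var_{π_{k/n}}(O)·a/(1−θ)` for every
  observable `O`: the lag of every observable along the protocol is `≲ ρσ̄σ_O/((1−ρ)n)` — the
  hypercontractive twin of the `χ²`-route statement "(θ/(1−θ))(σ̄/n)σ_O", `θ = ρe^{ΔD/(2n)}`
  (staged `GeneralLayerLagLaw`) and of the entropy route's `Scaling/EntropyMarginalCloseness`,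
  here with neither a sup-norm factor nor a log-MGF envelope.

Reading (value-free): the unweighted end-point ensemble of an NE-MCMC / SNF run (the X-3 arm with
weights dropped) is polynomially close to the target in `1/n_step` in every observable, so
observable offsets cannot flag dropped weights at production `n_step` — the weight bookkeeping is
the detector (HANDOFF P6/P18), now certified on the hypercontractive route as well.
NOT CLAIMED: any value of `ρ`; non-uniform grids.
-/

namespace Summit.Ventures.LatticeQCDFlow.Scaling

open Finset
open Literature.Probability.MarkovChains (stepLaw IsStationary)
open Literature.Probability.ImportanceSampling (chiSqDiv chiSqDiv_def chiSqDiv_eq_sum_sq_div)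
open Summit.Ventures.LatticeQCDFlow.Exactness
open Summit.Ventures.LatticeQCDFlow.Theory2

variable {X : Type*} [Fintype X] [Nonempty X]

/-! ## §1 The per-step deviation inequality (uniform grid, any real `t`) -/

/-- **PER-STEP DEVIATION INEQUALITY, HYPERCONTRACTIVE LAYERS.**  Along `c_k = k/n`, with
`ε = σ̄²/n²`: `dev4_{k+1} ≤ ρ·ḡ_k·(e^{(6t²−8t+3)ε/4}·dev4_k + √(e^{(t−1)²ε} − 1)·m_k)` where
`dev4_k = dev4 π_{k/n} ν_k^{(t)}`, `m_k = |ν_k^{(t)}|`, `ḡ_k = π_{k/n}[g_k]`. -/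
theorem dev4_tTiltLaw_succ_le_hc (t : ℝ) (S₀ D : X → ℝ) (P : ℕ → X → X → ℝ) {n : ℕ} (hn : n ≠ 0)
    {ρ σbar : ℝ} (hPpos : ∀ k x y, 0 < P k x y) (hProw : ∀ k x, ∑ y, P k x y = 1)
    (hst : ∀ k, IsStationary (gibbsLaw (linAction S₀ D (((k + 1 : ℕ) : ℝ) / n))) (P k))
    (hK : ∀ k, HyperContracts (P k) (gibbsLaw (linAction S₀ D (((k + 1 : ℕ) : ℝ) / n))) ρ)
    (hρ : 0 ≤ ρ) (hσ : ∀ c, varD S₀ D c ≤ σbar ^ 2) (k : ℕ) :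
    dev4 (gibbsLaw (linAction S₀ D (((k + 1 : ℕ) : ℝ) / n)))
        (tTiltLaw t S₀ D (fun k : ℕ => (k : ℝ) / n) P (k + 1))
      ≤ ρ * (∑ x, gibbsLaw (linAction S₀ D ((k : ℝ) / n)) x
              * tWeight t D (fun k : ℕ => (k : ℝ) / n) k x)
          * (Real.exp ((6 * t ^ 2 - 8 * t + 3) * (σbar ^ 2 / n ^ 2) / 4)
              * dev4 (gibbsLaw (linAction S₀ D ((k : ℝ) / n)))
                  (tTiltLaw t S₀ D (fun k : ℕ => (k : ℝ) / n) P k)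
            + Real.sqrt (Real.exp ((t - 1) ^ 2 * (σbar ^ 2 / n ^ 2)) - 1)
              * ∑ x, tTiltLaw t S₀ D (fun k : ℕ => (k : ℝ) / n) P k x) := by
  set c : ℕ → ℝ := fun k => (k : ℝ) / n with hc
  have hδ : c (k + 1) - c k = 1 / n := by rw [hc]; simp only; rw [uniform_step]
  have hcs : c (k + 1) = c k + 1 / n := by linarith [hδ]
  set ε : ℝ := σbar ^ 2 / n ^ 2 with hε
  have hsqε : ∀ r : ℝ, (r * (1 / n)) ^ 2 * σbar ^ 2 = r ^ 2 * ε := by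
    intro r; rw [hε]; field_simp
  set π : ℕ → X → ℝ := fun k => gibbsLaw (linAction S₀ D (c k)) with hπ
  set ν : ℕ → X → ℝ := fun k => tTiltLaw t S₀ D c P k with hν
  have hπpos : ∀ k x, 0 < π k x := fun k x => gibbsLaw_pos _ x
  have hπ1 : ∀ k, ∑ x, π k x = 1 := fun k => sum_gibbsLaw _
  have hgb0 : 0 < ∑ x, π k x * tWeight t D c k x := tEqFactor_pos t S₀ D c k
  have hm0 : 0 < ∑ x, ν k x := sum_pos (fun x _ => tTiltLaw_pos hPpos k x) univ_nonempty
  have hd0 : 0 ≤ dev4 (π k) (ν k) := dev4_nonneg _ _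
  have hck1 : gibbsLaw (linAction S₀ D (((k + 1 : ℕ) : ℝ) / n)) = π (k + 1) := by rw [hπ, hc]
  have step := dev4_tilt_stepLaw_le (ν := ν k) (hπpos k) (hπpos (k + 1)) (hπ1 (k + 1))
    hgb0 (hProw k) (by simpa only [hπ, hc] using hst k) (by simpa only [hπ, hc] using hK k) hρ
  rw [← tTiltLaw_succ] at step
  have hC := sqrt_sqrt_sum_tWeight_pow_four_le t S₀ D c hσ k
  rw [hδ, show (6 * t ^ 2 - 8 * t + 3) * (1 / (n : ℝ)) ^ 2 * σbar ^ 2 / 4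
      = (6 * t ^ 2 - 8 * t + 3) * ε / 4 by rw [hε]; field_simp] at hC
  have hχ : Real.sqrt (chiSqDiv (fun x => π k x * tWeight t D c k x / ∑ y, π k y * tWeight t D c k y)
        (π (k + 1))) ≤ Real.sqrt (Real.exp ((t - 1) ^ 2 * ε) - 1) := by
    refine Real.sqrt_le_sqrt ?_
    have htilt := tilt_gibbsLaw_eq_t t S₀ D c k
    simp only [hπ]
    rw [htilt, hδ, hcs, show c k + t * (1 / (n : ℝ)) = c k + 1 / n + (t - 1) * (1 / n) by ring]
    have h := chiSqDiv_gibbsLaw_linAction_le S₀ D (c k + 1 / n) ((t - 1) * (1 / n)) hσ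
    rwa [hsqε (t - 1)] at h
  have habs : |∑ x, ν k x| = ∑ x, ν k x := abs_of_pos hm0
  rw [habs] at step
  rw [hck1]
  calc dev4 (π (k + 1)) (tTiltLaw t S₀ D c P (k + 1))
      ≤ ρ * (Real.sqrt (Real.sqrt (∑ x, tWeight t D c k x ^ 4 * π k x ^ 3 / π (k + 1) x ^ 2))
            * dev4 (π k) (ν k)
          + (∑ x, ν k x) * (∑ x, π k x * tWeight t D c k x)
            * Real.sqrt (chiSqDiv (fun x => π k x * tWeight t D c k x
                / ∑ y, π k y * tWeight t D c k y) (π (k + 1)))) := step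
    _ ≤ ρ * ((∑ x, π k x * tWeight t D c k x) * Real.exp ((6 * t ^ 2 - 8 * t + 3) * ε / 4)
            * dev4 (π k) (ν k)
          + (∑ x, ν k x) * (∑ x, π k x * tWeight t D c k x)
            * Real.sqrt (Real.exp ((t - 1) ^ 2 * ε) - 1)) := by
        refine mul_le_mul_of_nonneg_left (add_le_add ?_ ?_) hρ
        · exact mul_le_mul_of_nonneg_right hC hd0
        · exact mul_le_mul_of_nonneg_left hχ (mul_nonneg hm0.le hgb0.le)
    _ = _ := by rw [hπ, hν]; ring

/-! ## §2 At `t = 0`: the marginals of the chain -/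

omit [Fintype X] [Nonempty X] in
/-- `tWeight 0 = 1`. -/
@[simp] theorem tWeight_zero_order (D : X → ℝ) (c : ℕ → ℝ) (k : ℕ) (x : X) :
    tWeight 0 D c k x = 1 := by
  simp [tWeight]

omit [Nonempty X] in
/-- At `t = 0` the tilted marginal is the marginal law of the chain started from `π_{c_0}`. -/
theorem tTiltLaw_zero_eq_evolveLaw (S₀ D : X → ℝ) (c : ℕ → ℝ) (P : ℕ → X → X → ℝ) :
    ∀ k, tTiltLaw 0 S₀ D c P k = evolveLaw P (gibbsLaw (linAction S₀ D (c 0))) k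
  | 0 => rfl
  | k + 1 => by
    rw [tTiltLaw_succ, evolveLaw_succ, ← tTiltLaw_zero_eq_evolveLaw S₀ D c P k]
    congr 1
    funext x
    rw [tWeight_zero_order, one_mul]

/-- **EVERY MARGINAL IS CLOSE TO EQUILIBRIUM IN `L⁴`.**  With `ε = σ̄²/n²`, `θ = ρe^{3ε/4} < 1`,
`a = ρ√(e^{ε} − 1)`: `dev4 π_{k/n} (μ_k) ≤ a/(1−θ)` for every `k`, `μ_k` the law of the chain after
`k` layers started in `π_0` (`≈ ρσ̄/((1−ρ)n)`). -/
theorem dev4_evolveLaw_le_hc (S₀ D : X → ℝ) (P : ℕ → X → X → ℝ) {n : ℕ} (hn : n ≠ 0)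
    {ρ σbar : ℝ} (hPpos : ∀ k x y, 0 < P k x y) (hProw : ∀ k x, ∑ y, P k x y = 1)
    (hst : ∀ k, IsStationary (gibbsLaw (linAction S₀ D (((k + 1 : ℕ) : ℝ) / n))) (P k))
    (hK : ∀ k, HyperContracts (P k) (gibbsLaw (linAction S₀ D (((k + 1 : ℕ) : ℝ) / n))) ρ)
    (hρ : 0 ≤ ρ) (hσ : ∀ c, varD S₀ D c ≤ σbar ^ 2)
    (hθ1 : ρ * Real.exp (3 * (σbar ^ 2 / n ^ 2) / 4) < 1) :
    ∀ k : ℕ, dev4 (gibbsLaw (linAction S₀ D ((k : ℝ) / n)))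
        (evolveLaw P (gibbsLaw (linAction S₀ D (((0 : ℕ) : ℝ) / n))) k)
      ≤ ρ * Real.sqrt (Real.exp (σbar ^ 2 / n ^ 2) - 1)
          / (1 - ρ * Real.exp (3 * (σbar ^ 2 / n ^ 2) / 4)) := by
  set c : ℕ → ℝ := fun k => (k : ℝ) / n with hc
  set θ := ρ * Real.exp (3 * (σbar ^ 2 / n ^ 2) / 4) with hθ
  set a := ρ * Real.sqrt (Real.exp (σbar ^ 2 / n ^ 2) - 1) with ha
  have h1θ : 0 < 1 - θ := by linarith
  have hθ0 : 0 ≤ θ := by positivity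
  have ha0 : 0 ≤ a := mul_nonneg hρ (Real.sqrt_nonneg _)
  -- masses are one and ḡ = 1 at t = 0
  have hmass : ∀ k, ∑ x, tTiltLaw 0 S₀ D c P k x = 1 := by
    intro k
    rw [tTiltLaw_zero_eq_evolveLaw, sum_evolveLaw P hProw, sum_gibbsLaw]
  have hgb : ∀ k, ∑ x, gibbsLaw (linAction S₀ D (c k)) x * tWeight 0 D c k x = 1 := by
    intro k; simp [sum_gibbsLaw]
  -- the recursion D_{k+1} ≤ θ D_k + a
  have hrec : ∀ k, dev4 (gibbsLaw (linAction S₀ D (c (k + 1)))) (tTiltLaw 0 S₀ D c P (k + 1))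
      ≤ θ * dev4 (gibbsLaw (linAction S₀ D (c k))) (tTiltLaw 0 S₀ D c P k) + a := by
    intro k
    have h := dev4_tTiltLaw_succ_le_hc 0 S₀ D P hn hPpos hProw hst hK hρ hσ k
    simp only [hc] at hgb hmass ⊢
    rw [hgb k, hmass k] at h
    have e3 : (6 * (0:ℝ) ^ 2 - 8 * 0 + 3) * (σbar ^ 2 / n ^ 2) / 4 = 3 * (σbar ^ 2 / n ^ 2) / 4 := by
      ring
    have e1 : ((0:ℝ) - 1) ^ 2 * (σbar ^ 2 / n ^ 2) = σbar ^ 2 / n ^ 2 := by ring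
    rw [e3, e1] at h
    refine h.trans (le_of_eq ?_)
    rw [hθ, ha]; ring
  intro k
  induction k with
  | zero =>
    have h0 : dev4 (gibbsLaw (linAction S₀ D (((0 : ℕ) : ℝ) / n)))
        (evolveLaw P (gibbsLaw (linAction S₀ D (((0 : ℕ) : ℝ) / n))) 0) = 0 := by
      rw [evolveLaw_zero]
      have := dev4_mul_self (gibbsLaw_pos (linAction S₀ D (((0 : ℕ) : ℝ) / n))) (sum_gibbsLaw _) 1
      simpa only [one_mul] using this
    rw [h0]
    exact div_nonneg ha0 h1θ.le
  | succ k ih =>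
    have hr := hrec k
    rw [tTiltLaw_zero_eq_evolveLaw, tTiltLaw_zero_eq_evolveLaw] at hr
    simp only [hc] at hr
    calc dev4 (gibbsLaw (linAction S₀ D (((k + 1 : ℕ) : ℝ) / n)))
          (evolveLaw P (gibbsLaw (linAction S₀ D (((0 : ℕ) : ℝ) / n))) (k + 1))
        ≤ θ * dev4 (gibbsLaw (linAction S₀ D ((k : ℝ) / n)))
            (evolveLaw P (gibbsLaw (linAction S₀ D (((0 : ℕ) : ℝ) / n))) k) + a := hr
      _ ≤ θ * (a / (1 - θ)) + a := by
          linarith [mul_le_mul_of_nonneg_left ih hθ0]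
      _ = a / (1 - θ) := by field_simp; ring

/-! ## §3 Consequences: `χ²` and observables -/

/-- **`χ²(μ_k ‖ π_{k/n}) ≤ (a/(1−θ))²`** for every marginal (`massDev ≤ dev4`, unit mass). -/
theorem chiSqDiv_evolveLaw_le_hc (S₀ D : X → ℝ) (P : ℕ → X → X → ℝ) {n : ℕ} (hn : n ≠ 0)
    {ρ σbar : ℝ} (hPpos : ∀ k x y, 0 < P k x y) (hProw : ∀ k x, ∑ y, P k x y = 1)
    (hst : ∀ k, IsStationary (gibbsLaw (linAction S₀ D (((k + 1 : ℕ) : ℝ) / n))) (P k))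
    (hK : ∀ k, HyperContracts (P k) (gibbsLaw (linAction S₀ D (((k + 1 : ℕ) : ℝ) / n))) ρ)
    (hρ : 0 ≤ ρ) (hσ : ∀ c, varD S₀ D c ≤ σbar ^ 2)
    (hθ1 : ρ * Real.exp (3 * (σbar ^ 2 / n ^ 2) / 4) < 1) (k : ℕ) :
    chiSqDiv (evolveLaw P (gibbsLaw (linAction S₀ D (((0 : ℕ) : ℝ) / n))) k)
        (gibbsLaw (linAction S₀ D ((k : ℝ) / n)))
      ≤ (ρ * Real.sqrt (Real.exp (σbar ^ 2 / n ^ 2) - 1)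
          / (1 - ρ * Real.exp (3 * (σbar ^ 2 / n ^ 2) / 4))) ^ 2 := by
  set π := gibbsLaw (linAction S₀ D ((k : ℝ) / n)) with hπ
  set μ := evolveLaw P (gibbsLaw (linAction S₀ D (((0 : ℕ) : ℝ) / n))) k with hμ
  have hπpos : ∀ x, 0 < π x := fun x => gibbsLaw_pos _ x
  have hμ1 : ∑ x, μ x = 1 := by rw [hμ, sum_evolveLaw P hProw, sum_gibbsLaw]
  have hdev := dev4_evolveLaw_le_hc S₀ D P hn hPpos hProw hst hK hρ hσ hθ1 k
  rw [← hπ, ← hμ] at hdev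
  have hmd : massDev π μ ≤ dev4 π μ := massDev_le_dev4 hπpos (sum_gibbsLaw _) μ
  have hm := massDev_of_sum_eq_one π hμ1
  have hsq : Real.sqrt (chiSqDiv μ π) ≤ _ := (hm ▸ hmd).trans hdev
  have h0 : 0 ≤ chiSqDiv μ π := by
    rw [chiSqDiv_eq_sum_sq_div]; exact sum_nonneg fun x _ => div_nonneg (sq_nonneg _) (hπpos x).le
  calc chiSqDiv μ π = Real.sqrt (chiSqDiv μ π) ^ 2 := (Real.sq_sqrt h0).symm
    _ ≤ _ := pow_le_pow_left₀ (Real.sqrt_nonneg _) hsq 2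

/-- **EVERY OBSERVABLE OF EVERY MARGINAL IS CLOSE TO ITS EQUILIBRIUM MEAN**:
`|E_{μ_k} O − ⟨O⟩_{k/n}| ≤ √Var_{π_{k/n}}(O) · a/(1−θ)` (`≈ ρσ̄σ_O/((1−ρ)n)`). -/
theorem abs_mean_evolveLaw_sub_le_hc (S₀ D : X → ℝ) (P : ℕ → X → X → ℝ) {n : ℕ} (hn : n ≠ 0)
    {ρ σbar : ℝ} (hPpos : ∀ k x y, 0 < P k x y) (hProw : ∀ k x, ∑ y, P k x y = 1)
    (hst : ∀ k, IsStationary (gibbsLaw (linAction S₀ D (((k + 1 : ℕ) : ℝ) / n))) (P k))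
    (hK : ∀ k, HyperContracts (P k) (gibbsLaw (linAction S₀ D (((k + 1 : ℕ) : ℝ) / n))) ρ)
    (hρ : 0 ≤ ρ) (hσ : ∀ c, varD S₀ D c ≤ σbar ^ 2)
    (hθ1 : ρ * Real.exp (3 * (σbar ^ 2 / n ^ 2) / 4) < 1) (k : ℕ) (O : X → ℝ) :
    |∑ x, O x * evolveLaw P (gibbsLaw (linAction S₀ D (((0 : ℕ) : ℝ) / n))) k x
        - ∑ x, gibbsLaw (linAction S₀ D ((k : ℝ) / n)) x * O x|
      ≤ Real.sqrt (varLaw (gibbsLaw (linAction S₀ D ((k : ℝ) / n))) O)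
          * (ρ * Real.sqrt (Real.exp (σbar ^ 2 / n ^ 2) - 1)
              / (1 - ρ * Real.exp (3 * (σbar ^ 2 / n ^ 2) / 4))) := by
  set π := gibbsLaw (linAction S₀ D ((k : ℝ) / n)) with hπ
  set μ := evolveLaw P (gibbsLaw (linAction S₀ D (((0 : ℕ) : ℝ) / n))) k with hμ
  have hπpos : ∀ x, 0 < π x := fun x => gibbsLaw_pos _ x
  have hμ1 : ∑ x, μ x = 1 := by rw [hμ, sum_evolveLaw P hProw, sum_gibbsLaw]
  have hdev := dev4_evolveLaw_le_hc S₀ D P hn hPpos hProw hst hK hρ hσ hθ1 k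
  rw [← hπ, ← hμ] at hdev
  have hlag := abs_sum_mul_sub_mass_mul_le hπpos (sum_gibbsLaw _) μ O
  rw [hμ1, one_mul] at hlag
  have hmd : massDev π μ ≤ dev4 π μ := massDev_le_dev4 hπpos (sum_gibbsLaw _) μ
  exact hlag.trans (mul_le_mul_of_nonneg_left (hmd.trans hdev) (Real.sqrt_nonneg _))

end Summit.Ventures.LatticeQCDFlow.Scaling
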